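import Summits.Ventures.CertifiedArithmetic.Expansions.Orient2dEstimate
import Mathlib.Tactic.NormNum

/-!
# Grids are kept by FAST-EXPANSION-SUM (with zero elimination) and by `estimate`

NEW WORK in the sense of this development (three bookkeeping lemmas; nothing here is a literature
fact, and nothing is claimed beyond the statements).  A rational `y` is ON THE GRID `2^s ℤ`
(`OnGrid s y`) if it is an integer multiple of `2^s`.  Round-to-nearest into `F(p, emin)` maps the
grid `2^s ℤ` into itself when `s ≥ emin` (`OnGrid.fl_of`), so every routine that only adds,
subtracts and rounds grid elements returns grid elements.  The library already records this for
GROW-EXPANSION (`onGrid_of_mem_growExpansion`), FAST-TWO-SUM (`onGrid_fastTwoSum`) and the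
SCALE-EXPANSION loop; this file adds the three consumers the stage-C assemblies of ORIENT3D /
INCIRCLE need:

* `onGrid_of_mem_fastExpansionSum` — FAST-EXPANSION-SUM of two lists of floats on `2^s ℤ`
  (`s ≥ emin`) has all its components on `2^s ℤ` (no sortedness or nonoverlapping hypothesis is
  needed: this is about grids, not about exactness);
* `onGrid_of_mem_fastExpansionSumZeroElim` — the same for `fast_expansion_sum_zeroelim`
  (`fastExpansionSumZeroElim` = FAST-EXPANSION-SUM followed by `zeroElim`; the padding `0` is on
  every grid);
* `onGrid_estimate` — `estimate(e) = ((e₁ ⊕ e₂) ⊕ e₃) ⊕ ⋯` of components on `2^s ℤ` (`s ≥ emin`)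
  lies on `2^s ℤ`.

Use: the stage-B value `det = estimate(fin1)` of `orient3dadapt` / `incircleadapt` lies on the grid
of the expansion `fin1`, so the stage-C products `resulterrbound ⊗ |det|` and the sum `det ⊕ c` are
roundings of grid elements, to which the standard-model error bounds of this library
(`abs_sub_fl_le_eps_mul_abs`, `…_abs_fl`) apply.

References: J. R. Shewchuk, Discrete Comput. Geom. 18 (1997) 305–363, §2.4 (FAST-EXPANSION-SUM),
§2.7 (`estimate` = APPROXIMATE) [Shewchuk1997].
-/

namespace Summit.Ventures.CertifiedArithmetic.Expansions

open Literature.ComputerArithmetic.JeannerodRump2018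
open Literature.ComputerArithmetic.BoldoJeannerodMelquiondMuller2023 hiding twoSum twoSum_fst
  isFloat_twoSum
open Literature.ComputerArithmetic.Shewchuk1997

variable {p : ℕ} {emin : ℤ} {fl : ℚ → ℚ}

/-- **FAST-EXPANSION-SUM keeps the grid**: if every component of `e` and of `f` is a float on
`2^s ℤ` (`s ≥ emin`), so is every component of `fastExpansionSum fl e f` (Line 2's FAST-TWO-SUM and
the GROW-EXPANSION loop only round sums and differences of grid elements). -/
theorem onGrid_of_mem_fastExpansionSum (hp : 1 ≤ p) (hfl : IsRoundNearest p emin fl) {s : ℤ}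
    (hs : emin ≤ s) {e f : List ℚ} (heF : ∀ x ∈ e, IsFloat p emin x)
    (hfF : ∀ x ∈ f, IsFloat p emin x) (heG : ∀ x ∈ e, OnGrid s x) (hfG : ∀ x ∈ f, OnGrid s x) :
    ∀ x ∈ fastExpansionSum fl e f, OnGrid s x := by
  have hgF : ∀ x ∈ mergeExpansions e f, IsFloat p emin x := fun x hx =>
    (mem_mergeExpansions.mp hx).elim (heF x) (hfF x)
  have hgG : ∀ x ∈ mergeExpansions e f, OnGrid s x := fun x hx =>
    (mem_mergeExpansions.mp hx).elim (heG x) (hfG x)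
  unfold fastExpansionSum
  generalize mergeExpansions e f = g at hgF hgG
  rcases g with _ | ⟨g₁, _ | ⟨g₂, gs⟩⟩
  · intro x hx; simp at hx
  · intro x hx; exact hgG x hx
  · have hg₁ : OnGrid s g₁ := hgG g₁ (by simp)
    have hg₂ : OnGrid s g₂ := hgG g₂ (by simp)
    have hgsG : ∀ y ∈ gs, OnGrid s y := fun y hy => hgG y (by simp [hy])
    have hgsF : ∀ y ∈ gs, IsFloat p emin y := fun y hy => hgF y (by simp [hy])
    obtain ⟨h1, h2⟩ := onGrid_fastTwoSum hp hfl hs hg₂ hg₁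
    intro x hx
    rcases List.mem_cons.mp hx with rfl | hx
    · exact h2
    · exact onGrid_of_mem_growExpansion hp hfl hs (isFloat_fastTwoSum hfl _ _).1 hgsF h1 hgsG x hx

/-- **`fast_expansion_sum_zeroelim` keeps the grid** (`fastExpansionSumZeroElim` =
FAST-EXPANSION-SUM then `zeroElim`; a surviving component is a component of the sum, the padding `0`
is on every grid). -/
theorem onGrid_of_mem_fastExpansionSumZeroElim (hp : 1 ≤ p) (hfl : IsRoundNearest p emin fl)
    {s : ℤ} (hs : emin ≤ s) {e f : List ℚ} (heF : ∀ x ∈ e, IsFloat p emin x)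
    (hfF : ∀ x ∈ f, IsFloat p emin x) (heG : ∀ x ∈ e, OnGrid s x) (hfG : ∀ x ∈ f, OnGrid s x) :
    ∀ x ∈ fastExpansionSumZeroElim fl e f, OnGrid s x := by
  intro x hx
  unfold fastExpansionSumZeroElim at hx
  rcases mem_zeroElim hx with ⟨hx, -⟩ | rfl
  · exact onGrid_of_mem_fastExpansionSum hp hfl hs heF hfF heG hfG x hx
  · exact OnGrid.zero s

/-- **`estimate` keeps the grid**: `estimate(e) = ((e₁ ⊕ e₂) ⊕ e₃) ⊕ ⋯` of components on `2^s ℤ`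
(`s ≥ emin`) lies on `2^s ℤ` (`estimate [] = 0` does too). -/
theorem onGrid_estimate (hp : 1 ≤ p) (hfl : IsRoundNearest p emin fl) {s : ℤ} (hs : emin ≤ s)
    {l : List ℚ} (hl : ∀ x ∈ l, OnGrid s x) : OnGrid s (estimate fl l) := by
  cases l with
  | nil => exact OnGrid.zero s
  | cons e es =>
    obtain ⟨he, hes⟩ := List.forall_mem_cons.mp hl
    show OnGrid s (es.foldl (fun Q x => fl (Q + x)) e)
    have key : ∀ (l : List ℚ) (Q : ℚ), (∀ x ∈ l, OnGrid s x) → OnGrid s Q →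
        OnGrid s (l.foldl (fun Q x => fl (Q + x)) Q) := by
      intro l
      induction l with
      | nil => intro Q _ hQ; simpa using hQ
      | cons x xs ih =>
        intro Q hl' hQ
        obtain ⟨hx, hxs⟩ := List.forall_mem_cons.mp hl'
        simp only [List.foldl_cons]
        exact ih _ hxs ((hQ.add hx).fl_of hp hfl hs)
    exact key es e hes he

end Summit.Ventures.CertifiedArithmetic.Expansions
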